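import Summits.QuantumFields.BalabanUV.Beta.GAN24.RespStepBmDecompPsi
import Literature.MathematicalPhysics.QuantumFieldTheory.Balaban1983to89.Beta.KernelWard

/-!
# `BalabanUV.Beta.GAN24.LegCompAssoc` — binder row G-an2-4 / (CONV-C), CT-ROUTE, (C4)-V plumbing: **ASSOCIATIVITY OF THE LEG COMPOSITION `legComp` FOR LOCALISED LEGS
# AND THE LEFT RECURSION OF `legChain`** — the dressed composite of the V lineage, `legComp R_i T′` after nesting, IS the chain `legChain (respStepBmSeq ρ Lc) i (n+1)`

NOT IN PRINT; OUR BOOKKEEPING (G-an2-4 formalisation swarm → CRUX TEAM (2), leaf prover `b2b-balaban-gan24-formalise-leaf-03`, gen 55; (C4)-V typist of record per the OWNER's W17,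
journal `CLAIMS.log` l.34977).  [folklore] one dominated Fubini (an5's `KernelWard.tsum_comm_of_prodBound` with a product majorant from the legs' localisation) over leaf-17's
`Push4.legComp`, leaf-01's `Push4Iter.legChain` ∕ `legDecay_legChain`, leaf-04's `Push4Bounds.LegDecay`, an2's ∕ leaf-01's dressed one-step responses
(`RespStepBmDecomp.legDecay_respStepBm_levels`, `RespStepBmDecompPsi.legDecay_respStep_of_decays ∕ decays_KStepUnit_levels`) BY NAME.  Generic `d`; 0 `def`, 0 cited facts,
0 `def … : Prop`, 0 sorry; NO estimate of Bałaban's.  HONEST FRAMING (cell contract, verbatim): «discharging `BetaPertH` makes Bałaban's UV stability UNCONDITIONAL — a real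
constructive-QFT result; it is NOT the continuum limit and NOT the Clay problem.»  HONEST DEPENDENCY (verbatim): «continuum YM on T⁴ ⇐ BetaPertH ∧ nine spine estimates (0/9
proved); BetaPertH ⇐ (D1) ∧ (D4) ∧ CAP+tail; G-an2-4 gates asym, D1 and NE2/3/4.»

## Why ((C4)-V module (C))
leaf-01's (V-1) dressed lineage is `D_{i,k} = w^{n+1} • push₃ T′ T′ T′ X_i` with the outer chain `T′ = legChain (respStepBmSeq ρ Lc) (i+1) n` as ONE leg and `X_i = w • (two mixed
one-step pushes through R_i = respStepBm ρ Lc (Lc^i) (Lc^(i+1)))`; after `Push3Nest.push₃_push₃` the field-slot legs are the composites `legComp R_i T′`, whereas the lineage-gauge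
letters of the tree (`ContactKernelCells.legChain_respStepBmSeq_sub_respStep`, `BornLambdaContactCells.exists_abs_lineageGauge_le`, `DressedLegEnvelope.exists_legChain_envelope`) speak
of `legChain (respStepBmSeq ρ Lc) i (n+1)` — `legChain` recurses on the COARSE end (`legChain_succ`).  §3 identifies the two.

## What (generic `d`)
* §1 **`legComp_assoc`**: `LegDecay a Na Ca ma` (`1 ≤ Na`, `0 < ma`), `b` bounded, `LegDecay c Nc Cc mc` (`0 < mc`) ⇒ `legComp a (legComp b c) = legComp (legComp a b) c`.
* §2 **`legChain_succ_left`**: levelwise localised legs (`∀ j, ∃ C m, 0 < m ∧ LegDecay (l j) N C m`, `1 ≤ N`) ⇒ `legChain l m₀ (k+1) = legComp (l m₀) (legChain l (m₀+1) k)`.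
* §3 **`legComp_respStepBm_legChain`** (in-block root, `1 ≤ Lc`): `legComp (respStepBm ρ Lc (Lc^i) (Lc^(i+1))) (legChain (respStepBmSeq ρ Lc) (i+1) n) = legChain (respStepBmSeq ρ Lc) i (n+1)`,
  and the undressed twin `legComp_respStep_legChain_respStep`-free form is leaf-12's `RespStepSemigroup.legComp_respStep` (one leg, no chain).
Discharges NO letter of (CONV-C); hCv ∕ hV ∕ hB ∕ hS0-comb OPEN; NEVER «G-an2-4 closed» as (CONV-C); NOT D1, NOT BetaPertH, NOT continuum, NOT Clay.
Unit `b2b-balaban-gan24-formalise-leaf-03` (gen 55), 2026-08-21.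
-/

noncomputable section

open Finset
open scoped BigOperators
open Literature.MathematicalPhysics.QuantumFieldTheory
open Literature.MathematicalPhysics.QuantumFieldTheory.Balaban1983to89
open Literature.MathematicalPhysics.QuantumFieldTheory.Balaban1983to89.Beta
open B12Sec2to5 (l1 l1_nonneg)
open ExpKernelCalculus (summable_exp_shift summable_exp_shift')
open KernelWard (ProdBound tsum_comm_of_prodBound)
open AffineAveraging (box toSite)
open BalabanCompositeJets (respStep)
open Summit.QuantumFields.BalabanUV.Beta.GAN24.Push4 (legComp legComp_apply)
open Summit.QuantumFields.BalabanUV.Beta.GAN24.Push4Bounds (LegDecay)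
open Summit.QuantumFields.BalabanUV.Beta.GAN24.Push4Iter (LegFam legChain legChain_zero legChain_succ legDecay_legChain)
open Summit.QuantumFields.BalabanUV.Beta.GAN24.RespStepBm (respStepBm)
open Summit.QuantumFields.BalabanUV.Beta.GAN24.RespStepBmDecomp (legDecay_respStepBm_levels)
open Summit.QuantumFields.BalabanUV.Beta.GAN24.RespStepBmDecompPsi (legDecay_respStep_of_decays decays_KStepUnit_levels)
open Summit.QuantumFields.BalabanUV.Beta.GAN24.RespStepBmDecompExact (respStepBmSeq)

namespace Summit.QuantumFields.BalabanUV.Beta.GAN24.LegCompAssoc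

variable {d : ℕ}

/-! ## §1 Associativity of `legComp` for localised legs -/

/-- [folklore] The OUTPUT-index decay of a localised leg makes it summable there: `LegDecay a N C m`, `1 ≤ N`, `0 < m` ⇒ `v ↦ a λ v κ u` summable. -/
theorem summable_out_of_legDecay {a : LegFam d} {N : ℕ} {C m : ℝ} (ha : LegDecay a N C m) (hN : 1 ≤ N) (hm : 0 < m) (lam κ : Fin (d + 1))
    (u : Fin (d + 1) → ℤ) : Summable fun v : Fin (d + 1) → ℤ => a lam v κ u := by
  have hinj : Function.Injective fun v : Fin (d + 1) → ℤ => (N : ℤ) • v :=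
    smul_right_injective (Fin (d + 1) → ℤ) (by exact_mod_cast (Nat.one_le_iff_ne_zero.1 hN) : (N : ℤ) ≠ 0)
  have h := ((summable_exp_shift hm u).comp_injective hinj).mul_left C
  refine Summable.of_norm_bounded h (fun v => ?_)
  rw [Real.norm_eq_abs]
  exact ha lam v κ u

/-- NOT IN PRINT; OUR BOOKKEEPING ([folklore]; one dominated Fubini).  **ASSOCIATIVITY OF THE LEG COMPOSITION**: for an innermost leg `a` localised at a blocking `Na ≥ 1`
(`LegDecay a Na Ca ma`, `0 < ma`), a bounded middle leg `b` and an outermost localised leg `c` (`LegDecay c Nc Cc mc`, `0 < mc`),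
`legComp a (legComp b c) = legComp (legComp a b) c` — both sides are the triple composite `c ∘ b ∘ a` (leaf-17's convention: `legComp r₂ r₁ = r₁ ∘ r₂`, `r₂` the inner leg); the
double series over the two middle sites is majorised by `(Σ_ν |c μ y ν w|)·C_b·(Σ_λ |a λ v κ u|)`, a product of summable functions (`KernelWard.tsum_comm_of_prodBound`). -/
theorem legComp_assoc {a b c : LegFam d} {Na Nc : ℕ} {Ca Cb Cc ma mc : ℝ} (ha : LegDecay a Na Ca ma) (hNa : 1 ≤ Na) (hma : 0 < ma)
    (hb : ∀ ν w lam v, |b ν w lam v| ≤ Cb) (hc : LegDecay c Nc Cc mc) (hmc : 0 < mc) :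
    legComp a (legComp b c) = legComp (legComp a b) c := by
  funext μ y κ u
  simp only [legComp_apply]
  have hCb : 0 ≤ Cb := (abs_nonneg _).trans (hb 0 0 0 0)
  -- the double summand
  set G : (Fin (d + 1) → ℤ) → (Fin (d + 1) → ℤ) → ℝ := fun v w => ∑ lam, ∑ ν, c μ y ν w * b ν w lam v * a lam v κ u with hG
  -- summabilities
  have has : ∀ lam, Summable fun v : Fin (d + 1) → ℤ => a lam v κ u := fun lam => summable_out_of_legDecay ha hNa hma lam κ u
  have hcs : ∀ ν, Summable fun w : Fin (d + 1) → ℤ => c μ y ν w := fun ν => hc.summable hmc μ y ν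
  have hba : ∀ ν w, Summable fun v : Fin (d + 1) → ℤ => ∑ lam, b ν w lam v * a lam v κ u := fun ν w =>
    summable_sum fun lam _ => by
      refine Summable.of_norm_bounded ((has lam).abs.mul_left Cb) (fun v => ?_)
      rw [Real.norm_eq_abs, abs_mul]
      exact mul_le_mul_of_nonneg_right (hb ν w lam v) (abs_nonneg _)
  have hcb : ∀ lam v, Summable fun w : Fin (d + 1) → ℤ => (∑ ν, c μ y ν w * b ν w lam v) * a lam v κ u := fun lam v =>
    (summable_sum fun ν _ => by
      refine Summable.of_norm_bounded ((hcs ν).abs.mul_right Cb) (fun w => ?_)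
      rw [Real.norm_eq_abs, abs_mul]
      exact mul_le_mul_of_nonneg_left (hb ν w lam v) (abs_nonneg _)).mul_right _
  -- LEFT: `Σ'_v Σ_λ (Σ'_w Σ_ν c·b)·a = Σ'_v Σ'_w G v w`
  have eL : ∀ v, (∑ lam, (∑' w, ∑ ν, c μ y ν w * b ν w lam v) * a lam v κ u) = ∑' w, G v w := by
    intro v
    have e1 : (∑ lam, (∑' w, ∑ ν, c μ y ν w * b ν w lam v) * a lam v κ u)
        = ∑ lam, ∑' w, (∑ ν, c μ y ν w * b ν w lam v) * a lam v κ u :=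
      Finset.sum_congr rfl fun lam _ => tsum_mul_right.symm
    rw [e1, ← Summable.tsum_finsetSum (fun lam _ => hcb lam v)]
    refine tsum_congr fun w => ?_
    rw [hG]
    exact Finset.sum_congr rfl fun lam _ => by rw [Finset.sum_mul]
  -- RIGHT: `Σ'_w Σ_ν c·(Σ'_v Σ_λ b·a) = Σ'_w Σ'_v G v w`
  have eR : ∀ w, (∑ ν, c μ y ν w * ∑' v, ∑ lam, b ν w lam v * a lam v κ u) = ∑' v, G v w := by
    intro w
    have e1 : (∑ ν, c μ y ν w * ∑' v, ∑ lam, b ν w lam v * a lam v κ u)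
        = ∑ ν, ∑' v, c μ y ν w * ∑ lam, b ν w lam v * a lam v κ u :=
      Finset.sum_congr rfl fun ν _ => tsum_mul_left.symm
    rw [e1, ← Summable.tsum_finsetSum (fun ν _ => (hba ν w).mul_left _)]
    refine tsum_congr fun v => ?_
    show (∑ ν, c μ y ν w * ∑ lam, b ν w lam v * a lam v κ u) = ∑ lam, ∑ ν, c μ y ν w * b ν w lam v * a lam v κ u
    rw [Finset.sum_comm]
    refine Finset.sum_congr rfl fun ν _ => ?_
    rw [Finset.mul_sum]
    exact Finset.sum_congr rfl fun lam _ => by ring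
  simp_rw [eL, eR]
  -- the product majorant
  have hPB : ProdBound G := by
    refine ⟨fun v => Cb * ∑ lam, |a lam v κ u|, fun w => ∑ ν, |c μ y ν w|,
      (summable_sum fun lam _ => (has lam).abs).mul_left Cb, summable_sum fun ν _ => (hcs ν).abs,
      fun v => mul_nonneg hCb (Finset.sum_nonneg fun _ _ => abs_nonneg _), fun w => Finset.sum_nonneg fun _ _ => abs_nonneg _, fun v w => ?_⟩
    rw [hG]
    calc |∑ lam, ∑ ν, c μ y ν w * b ν w lam v * a lam v κ u|
        ≤ ∑ lam, ∑ ν, |c μ y ν w * b ν w lam v * a lam v κ u| :=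
          (Finset.abs_sum_le_sum_abs _ _).trans (Finset.sum_le_sum fun lam _ => Finset.abs_sum_le_sum_abs _ _)
      _ ≤ ∑ lam, ∑ ν, |c μ y ν w| * Cb * |a lam v κ u| := Finset.sum_le_sum fun lam _ => Finset.sum_le_sum fun ν _ => by
          rw [abs_mul, abs_mul]
          exact mul_le_mul_of_nonneg_right (mul_le_mul_of_nonneg_left (hb ν w lam v) (abs_nonneg _)) (abs_nonneg _)
      _ = (Cb * ∑ lam, |a lam v κ u|) * ∑ ν, |c μ y ν w| := by
          rw [Finset.sum_comm, Finset.mul_sum]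
          refine Finset.sum_congr rfl fun ν _ => ?_
          rw [Finset.mul_sum, Finset.sum_mul]
          exact Finset.sum_congr rfl fun lam _ => by ring
  exact tsum_comm_of_prodBound hPB

/-! ## §2 The left recursion of `legChain` -/

/-- NOT IN PRINT; OUR BOOKKEEPING ([folklore]).  **THE CHAIN RECURSES ON THE FINE END TOO**: for levelwise localised legs (`∀ j, ∃ C m, 0 < m ∧ LegDecay (l j) N C m`, `1 ≤ N`),
`legChain l m₀ (k+1) = legComp (l m₀) (legChain l (m₀+1) k)` (induction on `k`, §1 with the bounded middle chain `legChain l (m₀+1) k` — leaf-01's `legDecay_legChain`). -/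
theorem legChain_succ_left {l : ℕ → LegFam d} {N : ℕ} (hN : 1 ≤ N) (hl : ∀ j, ∃ C m : ℝ, 0 < m ∧ LegDecay (l j) N C m) (m₀ : ℕ) :
    ∀ k, legChain l m₀ (k + 1) = legComp (l m₀) (legChain l (m₀ + 1) k)
  | 0 => by rw [legChain_succ, legChain_zero, legChain_zero, Nat.add_zero]
  | k + 1 => by
    rw [legChain_succ, legChain_succ_left hN hl m₀ k, legChain_succ, show m₀ + 1 + k + 1 = m₀ + (k + 1) + 1 by omega]
    obtain ⟨Ca, ma, hma, ha⟩ := hl m₀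
    obtain ⟨Cb, mb, hmb, hb⟩ := legDecay_legChain hl (m₀ + 1) k
    obtain ⟨Cc, mc, hmc, hc⟩ := hl (m₀ + (k + 1) + 1)
    exact (legComp_assoc ha hN hma (fun ν w lam v => hb.abs_le hmb.le ν w lam v) hc hmc).symm

/-! ## §3 The dressed composite of the V lineage is the chain -/

section Dressed

variable {Lc : ℕ} [NeZero Lc]

/-- [folklore] The dressed one-step responses are levelwise localised at blocking `Lc` (an2's window × leaf-01's `legDecay_respStep_of_decays` × `decays_KStepUnit_levels`). -/
theorem legDecay_respStepBmSeq (hLc : 1 ≤ Lc) {rr : Fin (d + 1) → ℕ} (hrr : rr ∈ box (d + 1) Lc) (j : ℕ) :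
    ∃ C m : ℝ, 0 < m ∧ LegDecay (respStepBmSeq (d := d) (toSite rr) Lc j) Lc C m :=
  legDecay_respStepBm_levels hLc hrr (fun j => by
    obtain ⟨C, m, hm, hK⟩ := decays_KStepUnit_levels (d := d) (Lc := Lc) j
    exact ⟨C, m, hm, legDecay_respStep_of_decays hK⟩) j

/-- NOT IN PRINT; OUR BOOKKEEPING ([folklore]; generic `d`, in-block root, `1 ≤ Lc`).  **THE DRESSED COMPOSITE AFTER NESTING IS THE CHAIN**:
`legComp (respStepBm ρ Lc (Lc^i) (Lc^(i+1))) (legChain (respStepBmSeq ρ Lc) (i+1) n) = legChain (respStepBmSeq ρ Lc) i (n+1)` — the field-slot legs of the nested V lineage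
`push₃ T′³ X_i` ARE the long dressed chains of the tree's lineage-gauge letters. -/
theorem legComp_respStepBm_legChain (hLc : 1 ≤ Lc) {rr : Fin (d + 1) → ℕ} (hrr : rr ∈ box (d + 1) Lc) (i n : ℕ) :
    legComp (respStepBm (toSite rr) Lc (Lc ^ i) (Lc ^ (i + 1))) (legChain (respStepBmSeq (d := d) (toSite rr) Lc) (i + 1) n)
      = legChain (respStepBmSeq (d := d) (toSite rr) Lc) i (n + 1) :=
  (legChain_succ_left hLc (legDecay_respStepBmSeq hLc hrr) i n).symm

end Dressed

end Summit.QuantumFields.BalabanUV.Beta.GAN24.LegCompAssoc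

end
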